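import Literature.Probability.RandomPlanarGeometry.HullKernelLimit
import Literature.Analysis.Complex.HydrodynamicDisplacement
import Mathlib.Analysis.Complex.AbsMax
import HarnessLib

/-!
# The maps of a `+`-hull in a disc of radius `r` move points by at most `6r` (Lawler's (3.12))

G. F. Lawler, *Conformally Invariant Processes in the Plane*, AMS (2005), Cor. 3.44, (3.12):
"for any `A`, `|g_A(z) - z| ≤ 3 rad(A)`, `z ∈ ℍ ∖ A`" (there from Brownian motion and the
maximum principle). For a nonempty `A ∈ 𝒬₊` contained in `B̄(x₀, r)` (`x₀ ∈ ℝ`) this file bridges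
the tree's Schwarz-reflected restriction map `E_A` (`IsPlusHull.extMap`, `PlusHullExtension`) to
the abstract hydrodynamic data of `Literature/Analysis/Complex/HydrodynamicExpansion.lean` and
PROVES the displacement bound, function-theoretically and with the constant `6`:

* `IsPlusHull.extShift` — the real number `L` with `E_A(z) - z → L` at `∞`, so that
  `g_A = E_A - L` is the hydrodynamically normalized map (`g_A(z) - z → 0`);
* `IsPlusHull.isHydrodynamicAt_extMap_sub` — **`g_A = E_A - L` is `IsHydrodynamicAt … x₀ r`**
  (holomorphic outside `B̄(x₀, r)`, symmetric, `im g_A ≤ im`), the input of Prop. 3.46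
  (`IsHydrodynamicAt.norm_sub_sub_div_le`) and of the omitted-value bound
  (`HydrodynamicDisplacement`);
* `IsPlusHull.norm_extMap_sub_extShift_sub_le` — **`|g_A(z) - z| ≤ 6r` for all `z ∈ Ω_A`**
  (inside `B̄(x₀, 2r)` by `IsHydrodynamicAt.norm_sub_self_le_of_injOn`; outside by the maximum
  modulus principle for the inverted function `w ↦ g_A(x₀ + 1/w) - x₀ - 1/w` on `|w| ≤ 1/(2r)`,
  whose boundary values are the previous case), whence `|L| ≤ 6r` (`E_A(0) = 0`) and
  `|E_A(z) - z| ≤ 12r` on `Ω_A` (`norm_extMap_sub_self_le`) — the uniform displacement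
  hypothesis of the kernel theorem `IsPlusHull.tendstoLocallyUniformlyOn_extMap_of_frontier`
  (`HullKernelLimit`) and of the modulus of continuity of `LengthAreaDiameter`.

No half-plane capacity is used or defined here.

## References

* G. F. Lawler (2005), Cor. 3.44 (3.12), §3.4 [Lawler2005].
-/

noncomputable section

open Set Filter Metric Complex Bornology Function
open _root_.Topology
open UpperHalfPlane (upperHalfPlaneSet isOpen_upperHalfPlaneSet)
open scoped ComplexConjugate
open Literature.Analysis.Complex (IsHydrodynamicAt invertAt)

namespace Literature.Probability.RandomPlanarGeometry

variable {A : Set ℂ} (hA : IsPlusHull A) (hne : A.Nonempty)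
include hA hne

/-! ### The shift `L` and the hydrodynamic map `g_A = E_A - L` -/

/-- **The shift `L ∈ ℝ`** with `E_A(z) - z → L` at `∞` (`IsPlusHull.exists_tendsto_extMap_sub`),
so that `g_A = E_A - L = Φ_A + g_A(0)` is Lawler's `g_A`. [cite: Lawler2005, §3.4 (Prop. 3.36)] -/
def IsPlusHull.extShift : ℝ := Classical.choose (hA.exists_tendsto_extMap_sub hne)

/-- `E_A(z) - z → L`. [folklore] -/
theorem IsPlusHull.tendsto_extMap_sub_extShift :
    Tendsto (fun z ↦ hA.extMap hne z - z) (cocompact ℂ) (𝓝 (hA.extShift hne : ℂ)) :=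
  Classical.choose_spec (hA.exists_tendsto_extMap_sub hne)

/-- Points of the closed upper half-plane off `A` and off `[x₀, x₁]` lie in `Ω_A`; in particular
every point outside a disc `B̄(x₀, r) ⊇ A` about a real centre does. [folklore] -/
theorem IsPlusHull.setOf_lt_norm_sub_subset_plusDomain {x₀ r : ℝ} (hsub : A ⊆ closedBall (x₀ : ℂ) r) :
    {z : ℂ | r < ‖z - x₀‖} ⊆ plusDomain A := by
  intro z hz hzK
  replace hz : r < ‖z - x₀‖ := hz
  have hnot : ∀ w ∈ A, ‖w - (x₀ : ℂ)‖ ≤ r := fun w hw ↦ by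
    simpa [dist_eq_norm] using hsub hw
  rcases hzK with ((hzA | hzA) | hzS)
  · exact absurd (hnot z hzA) (not_le.2 hz)
  · have h1 := hnot _ hzA
    have h2 : ‖conj z - (x₀ : ℂ)‖ = ‖z - x₀‖ := by
      have : conj z - (x₀ : ℂ) = conj (z - x₀) := by rw [map_sub, Complex.conj_ofReal]
      rw [this, Complex.norm_conj]
    rw [h2] at h1
    exact absurd h1 (not_le.2 hz)
  · rw [mem_realSeg_iff] at hzS
    obtain ⟨hzim, hzre⟩ := hzS
    have hp : |leftPt A - x₀| ≤ r := by
      have := hnot _ (hA.leftPt_mem hne)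
      rwa [← Complex.ofReal_sub, Complex.norm_real, Real.norm_eq_abs] at this
    have hq : |rightPt A - x₀| ≤ r := by
      have := hnot _ (hA.rightPt_mem hne)
      rwa [← Complex.ofReal_sub, Complex.norm_real, Real.norm_eq_abs] at this
    rw [uIcc_of_le (hA.leftPt_le_rightPt hne)] at hzre
    have hzeq : z = ((z.re : ℝ) : ℂ) := Complex.ext (by simp) (by simp [hzim])
    have hnorm : ‖z - x₀‖ = |z.re - x₀| := by
      rw [hzeq, ← Complex.ofReal_sub, Complex.norm_real, Real.norm_eq_abs, Complex.ofReal_re]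
    rw [hnorm] at hz
    rw [abs_le] at hp hq
    have : |z.re - x₀| ≤ r := abs_le.2 ⟨by linarith [hzre.1], by linarith [hzre.2]⟩
    exact absurd this (not_le.2 hz)

/-- **`g_A = E_A - L` is hydrodynamically normalized outside any disc `B̄(x₀, r) ⊇ A` about a
real centre**: holomorphic there, `g_A(z) - z → 0`, symmetric under conjugation, `im g_A ≤ im`.
[cite: Lawler2005, §3.4 (Prop. 3.36, Def. 3.37)] -/
theorem IsPlusHull.isHydrodynamicAt_extMap_sub {x₀ r : ℝ} (hr : 0 < r)
    (hsub : A ⊆ closedBall (x₀ : ℂ) r) :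
    IsHydrodynamicAt (fun z ↦ hA.extMap hne z - hA.extShift hne) x₀ r where
  pos := hr
  differentiableOn := ((hA.differentiableOn_extMap hne).mono
    (hA.setOf_lt_norm_sub_subset_plusDomain hne hsub)).sub_const _
  tendsto_sub := by
    have h := (hA.tendsto_extMap_sub_extShift hne).sub_const (hA.extShift hne : ℂ)
    rw [sub_self] at h
    refine h.congr fun z ↦ ?_
    ring
  map_conj z hz := by
    rw [hA.extMap_conj hne (hA.setOf_lt_norm_sub_subset_plusDomain hne hsub hz), map_sub,
      Complex.conj_ofReal]
  im_le z hz hzim := by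
    have hzA : z ∈ upperHalfPlaneSet \ A :=
      ⟨hzim, (hA.mem_plusDomain_iff_of_im_pos hzim).1
        (hA.setOf_lt_norm_sub_subset_plusDomain hne hsub hz)⟩
    have := hA.extMap_im_le_im hne hzA
    simpa using this

/-- `g_A` is injective on `Ω_A`. [folklore] -/
theorem IsPlusHull.injOn_extMap_sub : InjOn (fun z ↦ hA.extMap hne z - hA.extShift hne) (plusDomain A) :=
  fun _ hz _ hw h ↦ hA.injOn_extMap hne hz hw (sub_left_injective h)

/-! ### The displacement bound -/

/-- `|g_A(z) - z| ≤ 6r` on `Ω_A ∩ B̄(x₀, 2r)` (omitted values, `HydrodynamicDisplacement`). [cite: Lawler2005, Cor. 3.44 (3.12)] -/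
theorem IsPlusHull.norm_extMap_sub_extShift_sub_le_of_le {x₀ r : ℝ} (hr : 0 < r)
    (hsub : A ⊆ closedBall (x₀ : ℂ) r) {z : ℂ} (hz : z ∈ plusDomain A) (hz2 : ‖z - x₀‖ ≤ 2 * r) :
    ‖hA.extMap hne z - hA.extShift hne - z‖ ≤ 6 * r := by
  have h : ‖hA.extMap hne z - hA.extShift hne - z‖ ≤ 3 * max r ‖z - x₀‖ :=
    (hA.isHydrodynamicAt_extMap_sub hne hr hsub).norm_sub_self_le_of_injOn
      (hA.setOf_lt_norm_sub_subset_plusDomain hne hsub) (hA.injOn_extMap_sub hne) hz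
  have hmax : max r ‖z - x₀‖ ≤ 2 * r := max_le (by linarith) hz2
  linarith

/-- **Lawler's (3.12) for `+`-hulls: `|g_A(z) - z| ≤ 6r` for every `z ∈ Ω_A`**, `A ⊆ B̄(x₀, r)`
(in particular on `ℍ ∖ A` and at the real points off `[x₀ - r, x₀ + r]`): inside `B̄(x₀, 2r)` the
previous lemma; outside, the maximum modulus principle for the inverted function
`f(w) = g_A(x₀ + 1/w) - x₀ - 1/w` on the disc `|w| ≤ 1/(2r)`, whose boundary circle corresponds to
`|z - x₀| = 2r`. [cite: Lawler2005, Cor. 3.44 (3.12)] -/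
theorem IsPlusHull.norm_extMap_sub_extShift_sub_le {x₀ r : ℝ} (hr : 0 < r)
    (hsub : A ⊆ closedBall (x₀ : ℂ) r) {z : ℂ} (hz : z ∈ plusDomain A) :
    ‖hA.extMap hne z - hA.extShift hne - z‖ ≤ 6 * r := by
  rcases le_or_gt ‖z - x₀‖ (2 * r) with hle | hgt
  · exact hA.norm_extMap_sub_extShift_sub_le_of_le hne hr hsub hz hle
  set g : ℂ → ℂ := fun z ↦ hA.extMap hne z - hA.extShift hne with hg
  have hH : IsHydrodynamicAt g x₀ r := hA.isHydrodynamicAt_extMap_sub hne hr hsub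
  set f : ℂ → ℂ := invertAt g x₀ with hf
  -- the disc `|w| < 1/(2r)` and its boundary
  set R : ℝ := (2 * r)⁻¹ with hR
  have hR0 : 0 < R := by positivity
  have hRr : R < r⁻¹ := by
    rw [hR, inv_lt_inv₀ (by positivity) hr]; linarith
  have hfd : DiffContOnCl ℂ f (ball 0 R) := by
    refine DifferentiableOn.diffContOnCl ?_
    rw [closure_ball 0 hR0.ne']
    exact hH.differentiableOn_invertAt.mono (closedBall_subset_ball hRr)
  have hfr : ∀ w ∈ frontier (ball (0 : ℂ) R), ‖f w‖ ≤ 6 * r := by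
    intro w hw
    rw [frontier_ball 0 hR0.ne', mem_sphere_zero_iff_norm] at hw
    have hw0 : w ≠ 0 := by
      intro h0; rw [h0, norm_zero] at hw; exact hR0.ne' hw.symm
    set z' : ℂ := (x₀ : ℂ) + w⁻¹ with hz'
    have hnz : ‖z' - x₀‖ = 2 * r := by
      rw [hz', add_sub_cancel_left, norm_inv, hw, hR, inv_inv]
    have hz'mem : z' ∈ plusDomain A :=
      hA.setOf_lt_norm_sub_subset_plusDomain hne hsub (by rw [mem_setOf_eq, hnz]; linarith)
    have h1 := hA.norm_extMap_sub_extShift_sub_le_of_le hne hr hsub hz'mem hnz.le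
    rw [hf, IsHydrodynamicAt.invertAt_of_ne hw0]
    have : g ((x₀ : ℂ) + w⁻¹) - x₀ - w⁻¹ = hA.extMap hne z' - hA.extShift hne - z' := by
      rw [hg, hz']; ring
    rw [this]
    exact h1
  -- the point `w = 1/(z - x₀)` lies in the closed disc
  have hz0 : z - x₀ ≠ 0 := by
    intro h0; rw [h0, norm_zero] at hgt; linarith
  have hzx : z ≠ x₀ := sub_ne_zero.1 hz0
  have hwmem : (z - x₀)⁻¹ ∈ closure (ball (0 : ℂ) R) := by
    rw [closure_ball 0 hR0.ne', mem_closedBall_zero_iff, norm_inv, hR]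
    exact inv_anti₀ (by positivity) hgt.le
  have h := Complex.norm_le_of_forall_mem_frontier_norm_le isBounded_ball hfd hfr hwmem
  rw [hf, IsHydrodynamicAt.invertAt_inv_sub hzx] at h
  simpa [hg] using h

/-- `|L| ≤ 6r` (the bound at `z = 0 ∈ Ω_A`, where `E_A(0) = 0`). [folklore] -/
theorem IsPlusHull.abs_extShift_le {x₀ r : ℝ} (hr : 0 < r) (hsub : A ⊆ closedBall (x₀ : ℂ) r) :
    |hA.extShift hne| ≤ 6 * r := by
  have h := hA.norm_extMap_sub_extShift_sub_le hne hr hsub (hA.zero_mem_plusDomain hne)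
  rw [hA.extMap_zero hne, zero_sub, sub_zero, norm_neg, Complex.norm_real, Real.norm_eq_abs] at h
  exact h

/-- **`|E_A(z) - z| ≤ 12r` on `Ω_A`** for `A ⊆ B̄(x₀, r)`: the uniform displacement bound for the
reflected restriction maps (hypothesis `hC` of
`IsPlusHull.tendstoLocallyUniformlyOn_extMap_of_frontier`). [cite: Lawler2005, Cor. 3.44 (3.12)] -/
theorem IsPlusHull.norm_extMap_sub_self_le {x₀ r : ℝ} (hr : 0 < r) (hsub : A ⊆ closedBall (x₀ : ℂ) r)
    {z : ℂ} (hz : z ∈ plusDomain A) : ‖hA.extMap hne z - z‖ ≤ 12 * r := by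
  have h1 := hA.norm_extMap_sub_extShift_sub_le hne hr hsub hz
  have h2 := hA.abs_extShift_le hne hr hsub
  calc ‖hA.extMap hne z - z‖
      = ‖(hA.extMap hne z - hA.extShift hne - z) + (hA.extShift hne : ℂ)‖ := by ring_nf
    _ ≤ ‖hA.extMap hne z - hA.extShift hne - z‖ + ‖(hA.extShift hne : ℂ)‖ := norm_add_le _ _
    _ ≤ 6 * r + 6 * r := by
        rw [Complex.norm_real, Real.norm_eq_abs]; exact add_le_add h1 h2
    _ = 12 * r := by ring

/-- The same bound on `ℍ ∖ A` for the restriction map `Φ_A` itself. [cite: Lawler2005, Cor. 3.44 (3.12)] -/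
theorem IsPlusHull.norm_baseMap_sub_self_le {x₀ r : ℝ} (hr : 0 < r) (hsub : A ⊆ closedBall (x₀ : ℂ) r)
    {z : ℂ} (hz : z ∈ upperHalfPlaneSet \ A) : ‖hA.baseMap hne z - z‖ ≤ 12 * r := by
  rw [← hA.extMap_of_mem_diff hne hz]
  exact hA.norm_extMap_sub_self_le hne hr hsub (hA.diff_subset_plusDomain hz)

end Literature.Probability.RandomPlanarGeometry
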